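import Literature.AlgebraicGeometry.AbelianSchemes.TorsionPointsLocallyConstant
import Literature.AlgebraicGeometry.AbelianSchemes.AbelianSchemeConstSubgroupQuotient
import Literature.AlgebraicGeometry.AbelianSchemes.AbelianSchemeOverLevelBaseChange
import Literature.AlgebraicGeometry.AbelianSchemes.AbelianSchemeOverProductDecomposition
import Literature.AlgebraicGeometry.AbelianSchemes.DualPairUniqueOfStabilizer
import Mathlib.CategoryTheory.Monoidal.CommMon_
import HarnessLib

/-!
# The scheme-theoretic stabiliser of a family on `X ×_S Â` is a CONSTANT subgroup — assembly (K)

Mumford's «`K′ = K^⊥`» step of the dual-of-a-quotient construction ([MumfordAV1970] §15 Thm. 1), in the shape the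
uniqueness theorem ★ `DualPairUniqueOfStabilizer.eq_of_pullback_baseChangeToProd_iso_of_stabilizer` consumes as its
hypothesis `hK`:

> for every `f : T → S` and `T`-valued points `a, a′` of `B′` over `f`:
> `(1_X × a)^* N ≅ (1_X × a′)^* N  ⟹  a ≫ q = a′ ≫ q`,

for `X, B′` abelian schemes over `S`, `N` a module on `X ×_S B′`, and `q : B′ → B′/K′` the quotient by a finite group
`K′` of sections acting by translations (★ `quotientMk`).  This file ASSEMBLES it (`stabilizer_le_of_torsion_of_character`)
from:

* (K1)+(K2) **torsion** (hypothesis `hTors`): `(1 × a)^*N ≅ (1 × a′)^*N ⟹ a ≫ [n] = a′ ≫ [n]` — the ⊗-structure of the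
  Poincaré family and `ψ^*` / `[n]^*` ([MumfordAV1970] §8, §15; the cell's (P-⊗)/(SYM-n) files);
* (K3) **local constancy of `n`-torsion points** — ★ `TorsionPointsLocallyConstant`: given a level-`n` structure `φ` on
  `B′` and `n` invertible on `S`, the `n`-torsion `T`-point `a′⁻¹a` agrees with a CONSTANT section `σ^c` on a clopen
  neighbourhood of every point of `T`;
* (K4)+(K5) **character / exactness** (hypothesis `hChar`): if translating `a′` by the constant section `σ^c` preserves
  the class of `(1 × a′)^*N` over some NON-EMPTY `U → S`, then `σ^c ∈ K′`.

Then `a ≫ q = a′ ≫ q` on each member of a clopen cover of `T` (translations by `K′` are killed by `q`, ★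
`translation_comp_quotientMk`), hence everywhere (Mathlib `Scheme.Cover.hom_ext`).

## Main statements

* `pow_eq_comp_pow_id'` — `p ^ n = p ≫ [n]` for a `T`-valued point `p` (Mathlib `MonObj.comp_pow`);
* `toUnit_left_eq` — the underlying morphism of `toUnit T : T ⟶ 𝟙` in `Over S` is the structure map;
* `stabilizer_le_of_torsion_of_character` — the assembly (K).

## References

* [MumfordAV1970] D. Mumford, *Abelian Varieties* (1970), §15 Thm. 1 (p. 143); §23 (p. 231).
* [MilneAV2008] J. S. Milne, *Abelian Varieties* (2008), I §8 (pp. 36–37), I §9 Thm. 9.1.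
* [MumfordFogartyKirwan1994] D. Mumford, J. Fogarty, F. Kirwan, *GIT* (3rd ed.), Ch. 7 §2 Def. 7.1 (p. 129).
-/

noncomputable section

-- `(A.baseChange f).X = (Over.pullback f).obj A.X` / `(A.X ⊗ B.X).left = A.prodLeft B` hold by `rfl` only.
set_option backward.isDefEq.respectTransparency false

universe u

open CategoryTheory CategoryTheory.Limits AlgebraicGeometry MonoidalCategory CartesianMonoidalCategory
  TopologicalSpace

open scoped MonObj CategoryTheory.Obj

namespace Literature.AlgebraicGeometry.AbelianSchemes

namespace AbelianSchemeOver

variable {S : Scheme.{u}} (X B' : AbelianSchemeOver S)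

/-- `p ^ n = p ≫ [n]` for a `T`-valued point `p : T ⟶ B′` in `Over S` (Mathlib `MonObj.comp_pow`).
[cite: MumfordFogartyKirwan1994, Ch. 7 §2 Definition 7.1 (ii) (p. 129)] -/
theorem pow_eq_comp_pow_id' {T : Over S} (p : T ⟶ B'.X) (n : ℕ) :
    p ^ n = p ≫ ((𝟙 B'.X : B'.X ⟶ B'.X) ^ n) := by
  rw [MonObj.comp_pow, Category.comp_id]

/-- The underlying morphism of `toUnit T : T ⟶ 𝟙_ (Over S)` is the structure map of `T`. [folklore] -/
private theorem toUnit_left_eq (T : Over S) : (toUnit T).left = T.hom := by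
  have h := Over.w (toUnit T)
  rw [Over.tensorUnit_hom] at h
  exact (Category.comp_id (toUnit T).left).symm.trans h

/-- `(n : κ(f t)) ≠ 0 ⇒ (n : κ(t)) ≠ 0` along `f : T → S` (the residue field map is a ring map of fields). [folklore] -/
private theorem natCast_residueField_ne_zero_of_hom {T : Scheme.{u}} (f : T ⟶ S) {n : ℕ}
    (hn : ∀ s : S, (n : S.residueField s) ≠ 0) (t : T) : (n : T.residueField t) ≠ 0 := by
  intro h
  apply hn (f.base t)
  have hinj := (f.residueFieldMap t).hom.injective
  apply hinj
  rw [map_natCast, map_zero]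
  exact h

variable {Y : Scheme.{u}} (u : S ⟶ Y) (K' : Subgroup B'.Sections) [Finite K'] [Y.IsSeparated]
  [IsSeparated (B'.X.hom ≫ u)] [S.IsSeparated]
  (hcov' : ∀ x : B'.left, ∃ O : (B'.translationActionOver u K').StableAffineOpens, x ∈ O.1)
  (N : (X.prodLeft B').Modules) {g n : ℕ} (φ : LevelStructure g n B')

/-- **(K) ASSEMBLED: the scheme-theoretic stabiliser of `N` is contained in the constant group `K′`.**  Let `X, B′` be
abelian schemes over `S` (`B′` commutative, e.g. over a reduced base), `N` a module on `X ×_S B′`, `φ` a level-`n`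
structure on `B′` with `n` invertible on `S`, and `K′ ⊆ B′(S)` a finite subgroup with its free translation quotient
`q : B′ → B′/K′`.  Assume
(K1–K2) `hTors`: `(1 × a)^*N ≅ (1 × a′)^*N` forces `a ≫ [n] = a′ ≫ [n]` for all `T`-valued points `a, a′`;
(K4–K5) `hChar`: if for a constant section `σ^c = φ(c)` and a NON-EMPTY test scheme `U → S` the points `a′` and
`a = t_{σ^c} ∘ a′` have `(1 × a)^*N ≅ (1 × a′)^*N`, then `σ^c ∈ K′`.
Then for all `f : T → S` and `a, a′ : T → B′` over `f`: `(1 × a)^*N ≅ (1 × a′)^*N ⟹ a ≫ q = a′ ≫ q` — the hypothesis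
`hK` of ★ `eq_of_pullback_baseChangeToProd_iso_of_stabilizer`.  Proof: `b := a′⁻¹a` is `n`-torsion (`hTors`), hence
(★ `LevelStructure.exists_isClopen_comp_eq_section` for `B′_T`) agrees with a constant section `σ^c` on a clopen
neighbourhood `U` of any point of `T`; on `U`, `a = t_{σ^c} ∘ a′` and `hChar` puts `σ^c` in `K′`, whose translations `q`
kills (★ `translation_comp_quotientMk`); the `U` cover `T`. [cite: MumfordAV1970, §15 Thm. 1 (p. 143)]
[cite: MilneAV2008, I §8 (pp. 36–37)] -/
theorem stabilizer_le_of_torsion_of_character [IsCommMonObj B'.X] (hn : ∀ s : S, (n : S.residueField s) ≠ 0)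
    (hTors : ∀ {T : Scheme.{u}} (f : T ⟶ S) (a a' : T ⟶ B'.X.left) (ha : a ≫ B'.X.hom = f)
      (ha' : a' ≫ B'.X.hom = f),
      Nonempty ((Scheme.Modules.pullback (X.baseChangeToProd B' f a ha)).obj N ≅
        (Scheme.Modules.pullback (X.baseChangeToProd B' f a' ha')).obj N) →
      a ≫ (((𝟙 B'.X : B'.X ⟶ B'.X) ^ n : B'.X ⟶ B'.X)).left =
        a' ≫ (((𝟙 B'.X : B'.X ⟶ B'.X) ^ n : B'.X ⟶ B'.X)).left)
    (hChar : ∀ (c : Fin g ⊕ Fin g → ZMod n) {U : Scheme.{u}} (w : U ⟶ S) [Nonempty U] (a a' : U ⟶ B'.X.left)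
      (ha : a ≫ B'.X.hom = w) (ha' : a' ≫ B'.X.hom = w),
      a = a' ≫ (B'.translation (φ.section_ c)).left →
      Nonempty ((Scheme.Modules.pullback (X.baseChangeToProd B' w a ha)).obj N ≅
        (Scheme.Modules.pullback (X.baseChangeToProd B' w a' ha')).obj N) →
      φ.section_ c ∈ K')
    {T : Scheme.{u}} (f : T ⟶ S) (a a' : T ⟶ B'.X.left) (ha : a ≫ B'.X.hom = f) (ha' : a' ≫ B'.X.hom = f)
    (h : Nonempty ((Scheme.Modules.pullback (X.baseChangeToProd B' f a ha)).obj N ≅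
      (Scheme.Modules.pullback (X.baseChangeToProd B' f a' ha')).obj N)) :
    a ≫ (B'.quotientMk u K' hcov').left = a' ≫ (B'.quotientMk u K' hcov').left := by
  obtain ⟨e⟩ := h
  -- Step 0: the two `T`-valued points as morphisms `T₁ ⟶ B′` in `Over S`, `T₁ := (T, 𝟙 ≫ f)`
  let T₁ : Over S := (Over.map f).obj (𝟙_ (Over T))
  have hT₁ : T₁.hom = 𝟙 T ≫ f := by
    change (𝟙_ (Over T)).hom ≫ f = _
    rw [Over.tensorUnit_hom]
  let pa : T₁ ⟶ B'.X := Over.homMk a (by rw [hT₁, Category.id_comp]; exact ha)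
  let pa' : T₁ ⟶ B'.X := Over.homMk a' (by rw [hT₁, Category.id_comp]; exact ha')
  have hpal : pa.left = a := rfl
  have hpal' : pa'.left = a' := rfl
  -- Step 1 (K1–K2): `b := a′⁻¹ a` is `n`-torsion
  have hpow : pa ^ n = pa' ^ n := by
    rw [B'.pow_eq_comp_pow_id' pa n, B'.pow_eq_comp_pow_id' pa' n]
    ext
    rw [Over.comp_left, Over.comp_left, hpal, hpal']
    exact hTors f a a' ha ha' ⟨e⟩
  let b : T₁ ⟶ B'.X := pa'⁻¹ * pa
  have hb : b ^ n = 1 := by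
    change (pa'⁻¹ * pa) ^ n = 1
    rw [mul_pow, inv_pow, hpow, inv_mul_cancel]
  have hpab : pa = pa' * b := by
    change pa = pa' * (pa'⁻¹ * pa)
    rw [mul_inv_cancel_left]
  -- Step 2: `b` as a section of `B′_T → T`
  let E : (T₁ ⟶ B'.X) →* ((𝟙_ (Over T)) ⟶ (Over.pullback f).obj B'.X) :=
    MonoidHom.mk' (fun p => (Over.mapPullbackAdj f).homEquiv (𝟙_ (Over T)) B'.X p) (homEquiv_mul f)
  let sb : (B'.baseChange f).Sections := (Over.mapPullbackAdj f).homEquiv (𝟙_ (Over T)) B'.X b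
  have hsb : sb ^ n = 1 := by
    have h1 : E (b ^ n) = E b ^ n := map_pow E b n
    rw [hb, map_one] at h1
    exact h1.symm
  have hsb_fst : sb.left ≫ pullback.fst B'.X.hom f = b.left := homEquiv_left_fst f b
  -- Step 3 (K3): on a clopen neighbourhood of every `t ∈ T`, `b` is the constant section `σ^{c t}`
  have hnT : ∀ t : T, (n : T.residueField t) ≠ 0 := natCast_residueField_ne_zero_of_hom f hn
  haveI : IsCommMonObj (B'.baseChange f).X :=
    ⟨(Functor.isCommMonObj_obj (F := Over.pullback f) (M := B'.X)).mul_comm⟩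
  have key := fun t : T =>
    (φ.baseChange f).exists_isClopen_comp_eq_section (B'.baseChange f) hnT hsb t
  choose c U hUc htU hEq using key
  -- the equation read on `B′` itself: `U_t → T → B′`, `b = f ≫ σ^c` on `U_t`
  have hsec : ∀ t, ((φ.baseChange f).section_ (c t)).left ≫ pullback.fst B'.X.hom f =
      f ≫ (φ.section_ (c t)).left := fun t => by
    have h1 : (φ.baseChange f).section_ (c t) = B'.sectionBaseChange f (φ.section_ (c t)) :=
      (B'.sectionBaseChange_sectionPow f φ.σ (c t)).symm
    rw [h1]
    exact B'.sectionBaseChange_left_comp_fst f _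
  have hbU : ∀ t, (U t).ι ≫ b.left = ((U t).ι ≫ f) ≫ (φ.section_ (c t)).left := fun t => by
    have h1 := congrArg (· ≫ pullback.fst B'.X.hom f) (hEq t)
    simp only [Category.assoc] at h1
    rw [hsb_fst, hsec] at h1
    rw [Category.assoc]
    exact h1
  -- Step 4: on each `U_t`, `a ≫ q = a′ ≫ q`
  have hloc : ∀ t, (U t).ι ≫ (a ≫ (B'.quotientMk u K' hcov').left) =
      (U t).ι ≫ (a' ≫ (B'.quotientMk u K' hcov').left) := by
    intro t
    rcases isEmpty_or_nonempty (U t : Scheme.{u}) with hemp | hne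
    · exact (isInitialOfIsEmpty (X := (U t : Scheme.{u}))).hom_ext _ _
    -- the `U_t`-valued points
    let T₁U : Over S := (Over.map ((U t).ι ≫ f)).obj (𝟙_ (Over (U t : Scheme.{u})))
    have hT₁U : T₁U.hom = 𝟙 _ ≫ (U t).ι ≫ f := by
      change (𝟙_ (Over (U t : Scheme.{u}))).hom ≫ ((U t).ι ≫ f) = 𝟙 _ ≫ (U t).ι ≫ f
      rw [Over.tensorUnit_hom]
    let ιpt : T₁U ⟶ T₁ := Over.homMk (U t).ι (by rw [hT₁U, hT₁, Category.id_comp, Category.id_comp])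
    have hιpt : ιpt.left = (U t).ι := rfl
    have hbU' : ιpt ≫ b = toUnit T₁U ≫ φ.section_ (c t) := by
      ext
      rw [Over.comp_left, Over.comp_left, toUnit_left_eq, hT₁U, Category.id_comp, hιpt]
      exact hbU t
    have hpaU : ιpt ≫ pa = (ιpt ≫ pa') ≫ B'.translation (φ.section_ (c t)) := by
      rw [comp_translation, hpab, MonObj.comp_mul, hbU', mul_comm]
    have heqU : (U t).ι ≫ a = ((U t).ι ≫ a') ≫ (B'.translation (φ.section_ (c t))).left := by
      have h1 := congrArg Over.Hom.left hpaU
      rw [Over.comp_left, Over.comp_left, Over.comp_left, hιpt, hpal, hpal'] at h1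
      exact h1
    -- the isomorphism restricted to `U_t`
    have haU : ((U t).ι ≫ a) ≫ B'.X.hom = (U t).ι ≫ f := by rw [Category.assoc, ha]
    have haU' : ((U t).ι ≫ a') ≫ B'.X.hom = (U t).ι ≫ f := by rw [Category.assoc, ha']
    obtain ⟨j₁⟩ := X.nonempty_pullback_prodMap_pullback_baseChangeToProd_iso B' N ((U t).ι ≫ f) f (U t).ι rfl a ha
    obtain ⟨j₂⟩ := X.nonempty_pullback_prodMap_pullback_baseChangeToProd_iso B' N ((U t).ι ≫ f) f (U t).ι rfl a' ha'
    have hisoU : Nonempty ((Scheme.Modules.pullback (X.baseChangeToProd B' ((U t).ι ≫ f) ((U t).ι ≫ a) haU)).obj N ≅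
        (Scheme.Modules.pullback (X.baseChangeToProd B' ((U t).ι ≫ f) ((U t).ι ≫ a') haU')).obj N) :=
      ⟨j₁.symm ≪≫ (Scheme.Modules.pullback _).mapIso e ≪≫ j₂⟩
    have hmem : φ.section_ (c t) ∈ K' :=
      hChar (c t) ((U t).ι ≫ f) ((U t).ι ≫ a) ((U t).ι ≫ a') haU haU' heqU hisoU
    -- translations by `K′` are killed by `q`
    have hkill := congrArg Over.Hom.left (B'.translation_comp_quotientMk u K' hcov' ⟨_, hmem⟩)
    rw [Over.comp_left] at hkill
    calc (U t).ι ≫ a ≫ (B'.quotientMk u K' hcov').left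
        = (((U t).ι ≫ a') ≫ (B'.translation (φ.section_ (c t))).left) ≫ (B'.quotientMk u K' hcov').left := by
          rw [← Category.assoc, heqU]
      _ = ((U t).ι ≫ a') ≫ ((B'.translation (φ.section_ (c t))).left ≫ (B'.quotientMk u K' hcov').left) := by
          rw [Category.assoc]
      _ = (U t).ι ≫ a' ≫ (B'.quotientMk u K' hcov').left := by
          rw [hkill, Category.assoc]
  -- Step 5: the `U_t` cover `T`
  have hUcov : IsOpenCover U := top_le_iff.mp fun t _ => Opens.mem_iSup.mpr ⟨t, htU t⟩
  exact Scheme.Cover.hom_ext (T.openCoverOfIsOpenCover U hUcov) _ _ hloc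

end AbelianSchemeOver

end Literature.AlgebraicGeometry.AbelianSchemes

end
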